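/-
Copyright (c) 2026. All rights reserved.
Released under Apache 2.0 license as described in the file LICENSE.
Authors: abc-iut cell — seat abc-iut-w4-d104 (gen 3): row «COR29-GLOBALISE» (L4-lead RULING #7e), generic
chart-package lemmas, rows (b), for [AbsTopIII] Cor 2.9 over an abstract space.
-/
import Literature.AnabelianGeometry.AbsoluteAnabelian.ArchimedeanReconstructionCor29ModelProofs
import Literature.AnabelianGeometry.AbsoluteAnabelian.LocalLinearHolStructureComap
import HarnessLib

/-!
# [AbsTopIII] Cor 2.9 (b) along a CHART PACKAGE of an abstract space: the scalar of a germ automorphism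
# and the field isomorphism `𝒜_x ∪ {0} ⥲ k_v`, through `κ : ℂ ≃ k_v`

S. Mochizuki, *Topics in absolute anabelian geometry III* (bib key `MochizukiAbsTopIII2015`), Cor 2.9 (b),
kurims p.65 l.14–29.  PROOF-ONLY file (no definitions), sibling of
`ArchimedeanReconstructionCor29ChartPackage.lean` (rows (a)).  For a chart package `(W, e, e', r)` at `x` of a
topological space `X` (charts valued in `ℂ`) and a field `𝕜` with `κ : ℂ ≃+* 𝕜` (and its units part
`κu : ℂ^× ≃ 𝕜^×`), the local linear holomorphic structure is `𝒜_x := germAut 0` read in the chart centred at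
`x` — the pull-back `planeStructure.comap (fun _ ↦ 0)` of abc-iut-w5-d225's plane structure — acting near
`x` by `u · v := e'(e x + c_u (e v − e x))`, with `ι(v) := κ(e v − e x) • id` and the transported
`a +ₓ b := e'(e a + e b − e x)`; the scalar isomorphism is `E := (multiplier) ≫ κu : 𝒜_x ⥲ 𝕜^×`.  Over the
sub-DAG statements of p414208:

* `actionScalar_pkg` (b.r1, `AR.Cor29.ActionScalar`) — the unique scalar of `u` is `κ(c_u)`;
* `scalarFieldIso_pkg` (b.r2, `AR.Cor29.ScalarFieldIso`) — `E` is the scalar and is additive for the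
  action-defined sum;
* `scalarCompatibleWithTrans_pkg` (b.r4, `AR.Cor29.ScalarCompatibleWithTrans`) — with every point the
  origin of its own chart the transition isomorphisms are identities;
* helpers `eventually_pkg_act`, `exists_ne_of_eventually_pkg`, `iota_pkgAct_eventually`.

Refereed pre-IUT material; nothing here bears on the disputed [IUTchIII] Cor. 3.12; typed ≠ endorsed.
-/

noncomputable section

namespace Literature.AnabelianGeometry.AbsoluteAnabelian

open _root_.Set _root_.Topology _root_.Filter _root_.Metric _root_.Function
open ArchimedeanReconstruction ArchimedeanReconstruction.Cor29

namespace ArchimedeanReconstruction.Cor29ChartPackage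

variable {X : Type} [TopologicalSpace X]
variable {W : Set X} {e : X → ℂ} {e' : ℂ → X} {x : X} {r : ℝ}

section Values

variable {𝕜 : Type*} [NontriviallyNormedField 𝕜]

/-! ### Rows b.r1–b.r4: the scalar of a germ automorphism (through `κ : ℂ ≃ k_v`) -/

/-- Near `x`, the chart-conjugated affine action with multiplier `c` reads `e(act v) = e x + c (e v − e x)`.
(Auxiliary.) [cite: MochizukiAbsTopIII2015, Corollary 2.9 (b) p.65] -/
theorem eventually_pkg_act (hWo : IsOpen W) (hxW : x ∈ W) (he : ContinuousOn e W)
    (hem : MapsTo e W (ball (e x) r)) (hrt : ∀ w ∈ ball (e x) r, e (e' w) = w) (c : ℂ) :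
    ∀ᶠ v in 𝓝 x, e x + c * (e v - e x) ∈ ball (e x) r ∧
      e (e' (e x + c * (e v - e x))) = e x + c * (e v - e x) := by
  have hcont : ContinuousAt (fun v => e x + c * (e v - e x)) x :=
    continuousAt_const.add (continuousAt_const.mul
      (((he x hxW).continuousAt (hWo.mem_nhds hxW)).sub continuousAt_const))
  have h0 : e x + c * (e x - e x) ∈ ball (e x) r := by
    rw [sub_self, mul_zero, add_zero]; exact hem hxW
  have hmem : ∀ᶠ v in 𝓝 x, e x + c * (e v - e x) ∈ ball (e x) r :=
    hcont.preimage_mem_nhds (isOpen_ball.mem_nhds h0)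
  filter_upwards [hmem] with v hv
  exact ⟨hv, hrt _ hv⟩

/-- A property holding near `x` holds at some `v ∈ W` with `e v ≠ e x`, provided `x` is not isolated in
`W` for the chart (the chart image is a ball, which has no isolated points). (Auxiliary.)
[cite: MochizukiAbsTopIII2015, Corollary 2.9 (b) p.65] -/
theorem exists_ne_of_eventually_pkg (hr : 0 < r) (hxW : x ∈ W)
    (he' : ContinuousOn e' (ball (e x) r)) (he'm : MapsTo e' (ball (e x) r) W)
    (hl : ∀ v ∈ W, e' (e v) = v) (hrt : ∀ w ∈ ball (e x) r, e (e' w) = w)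
    {P : X → Prop} (h : ∀ᶠ v in 𝓝 x, P v) : ∃ v, v ∈ W ∧ e v ≠ e x ∧ P v := by
  have h1 : ∀ᶠ w in 𝓝[ball (e x) r] (e x), P (e' w) := by
    have ht := (he' (e x) (mem_ball_self hr)).tendsto
    rw [hl x hxW] at ht
    exact ht.eventually h
  have h2 : ∀ᶠ w in 𝓝 (e x), w ∈ ball (e x) r → P (e' w) := eventually_nhdsWithin_iff.1 h1
  have h3a : ∀ᶠ w in 𝓝 (e x), w ∈ ball (e x) r := isOpen_ball.mem_nhds (mem_ball_self hr)
  have h3 : ∀ᶠ w in 𝓝 (e x), w ∈ ball (e x) r ∧ (w ∈ ball (e x) r → P (e' w)) := h3a.and h2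
  haveI : (𝓝[≠] (e x)).NeBot := NormedField.nhdsNE_neBot (e x)
  have h4 : ∀ᶠ w in 𝓝[≠] (e x), (w ∈ ball (e x) r ∧ (w ∈ ball (e x) r → P (e' w))) ∧
      w ∈ ({e x}ᶜ : Set ℂ) := (h3.filter_mono nhdsWithin_le_nhds).and self_mem_nhdsWithin
  obtain ⟨w, ⟨hwb, hwP⟩, hwne⟩ := h4.exists
  refine ⟨e' w, he'm hwb, ?_, hwP hwb⟩
  rw [hrt w hwb]
  exact Set.mem_compl_singleton_iff.1 hwne

/-- In the chart, `ι(act u v) = κ(c_u) • ι(v)` near `x`. (Auxiliary for rows b.r1/b.r2.)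
[cite: MochizukiAbsTopIII2015, Corollary 2.9 (b) p.65] -/
theorem iota_pkgAct_eventually (κ : ℂ ≃+* 𝕜) (hWo : IsOpen W) (hxW : x ∈ W) (he : ContinuousOn e W)
    (hem : MapsTo e W (ball (e x) r)) (hrt : ∀ w ∈ ball (e x) r, e (e' w) = w) (c : ℂ) :
    ∀ᶠ v in 𝓝 x, ((κ (e (e' (e x + c * (e v - e x))) - e x)) • (LinearMap.id : 𝕜 →ₗ[𝕜] 𝕜)) =
      κ c • ((κ (e v - e x)) • (LinearMap.id : 𝕜 →ₗ[𝕜] 𝕜)) := by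
  filter_upwards [eventually_pkg_act hWo hxW he hem hrt c] with v hv
  refine LinearMap.ext fun ω => ?_
  simp only [LinearMap.smul_apply, LinearMap.id_apply, smul_eq_mul]
  rw [hv.2, add_sub_cancel_left, map_mul, mul_assoc]

/-- **Row b.r1 for a chart package** (`ActionScalar`): every `u ∈ 𝒜_x` has a UNIQUE scalar
`a ∈ k_v^×` with `ι(act u v) = a • ι(v)` near `x`, namely `κ(c_u)`.
[cite: MochizukiAbsTopIII2015, Corollary 2.9 (b) p.65] -/
theorem actionScalar_pkg (κ : ℂ ≃+* 𝕜) (κu : ℂˣ ≃ₜ* 𝕜ˣ) (hκu : ∀ c : ℂˣ, ((κu c : 𝕜ˣ) : 𝕜) = κ c)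
    (hr : 0 < r) (hWo : IsOpen W) (hxW : x ∈ W) (he : ContinuousOn e W)
    (hem : MapsTo e W (ball (e x) r)) (he' : ContinuousOn e' (ball (e x) r))
    (he'm : MapsTo e' (ball (e x) r) W) (hl : ∀ v ∈ W, e' (e v) = v)
    (hrt : ∀ w ∈ ball (e x) r, e (e' w) = w) :
    ActionScalar (𝕜 := 𝕜) (A := (Cor29Model.planeStructure.comap (fun _ : X => (0 : ℂ))).A x)
      (fun u v => e' (e x +
        (((Cor29Model.mult 0 : (Cor29Model.planeStructure.comap (fun _ : X => (0 : ℂ))).A x ≃ₜ* ℂˣ) u :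
          ℂˣ) : ℂ) * (e v - e x))) x
      (fun v => (κ (e v - e x)) • (LinearMap.id : 𝕜 →ₗ[𝕜] 𝕜)) := by
  intro u
  beta_reduce
  set c : ℂˣ := (Cor29Model.mult 0 :
    (Cor29Model.planeStructure.comap (fun _ : X => (0 : ℂ))).A x ≃ₜ* ℂˣ) u with hc
  refine ⟨κu c, ?_, fun a ha => ?_⟩
  · have h := iota_pkgAct_eventually κ hWo hxW he hem hrt (c : ℂ)
    refine h.mono fun v hv => ?_
    rw [hv, hκu]
  · obtain ⟨v, -, hne, hv⟩ := exists_ne_of_eventually_pkg hr hxW he' he'm hl hrt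
      (ha.and (eventually_pkg_act hWo hxW he hem hrt (c : ℂ)))
    obtain ⟨hva, -, hv2⟩ := hv
    have h1 := LinearMap.congr_fun hva 1
    simp only [LinearMap.smul_apply, LinearMap.id_apply, smul_eq_mul, mul_one] at h1
    rw [hv2, add_sub_cancel_left, map_mul] at h1
    have hvx : κ (e v - e x) ≠ 0 := by
      rw [map_ne_zero_iff κ κ.injective]; exact sub_ne_zero.2 hne
    have h2 : κ (c : ℂ) = (a : 𝕜) := mul_right_cancel₀ hvx h1
    exact Units.ext (by rw [hκu]; exact h2.symm)

/-- **Row b.r2 for a chart package** (`ScalarFieldIso`), with `𝒜_x := germAut 0` read in the chart centred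
at `x` (the pull-back `planeStructure.comap (fun _ ↦ 0)`), acting near `x` by
`act u v := e⁻¹(e x + c_u (e v − e x))`, and the scalar isomorphism `E := (multiplier) ≫ κ` on units
(`κu : ℂ^× ≃ k_v^×` the units part of `κ`): `E` is the scalar of the action and is additive for the
action-defined sum w.r.t. the transported `+ₓ`. [cite: MochizukiAbsTopIII2015, Corollary 2.9 (b) p.65] -/
theorem scalarFieldIso_pkg (κ : ℂ ≃+* 𝕜) (κu : ℂˣ ≃ₜ* 𝕜ˣ) (hκu : ∀ c : ℂˣ, ((κu c : 𝕜ˣ) : 𝕜) = κ c)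
    (hr : 0 < r) (hWo : IsOpen W) (hxW : x ∈ W) (he : ContinuousOn e W)
    (hem : MapsTo e W (ball (e x) r)) (he' : ContinuousOn e' (ball (e x) r))
    (he'm : MapsTo e' (ball (e x) r) W) (hl : ∀ v ∈ W, e' (e v) = v)
    (hrt : ∀ w ∈ ball (e x) r, e (e' w) = w) :
    ScalarFieldIso (𝕜 := 𝕜) (Cor29Model.planeStructure.comap (fun _ : X => (0 : ℂ))) x
      (fun u v => e' (e x +
        (((Cor29Model.mult 0 : (Cor29Model.planeStructure.comap (fun _ : X => (0 : ℂ))).A x ≃ₜ* ℂˣ) u :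
          ℂˣ) : ℂ) * (e v - e x)))
      (fun a b => e' (e a + e b - e x))
      (fun v => (κ (e v - e x)) • (LinearMap.id : 𝕜 →ₗ[𝕜] 𝕜))
      ((Cor29Model.mult 0 : (Cor29Model.planeStructure.comap (fun _ : X => (0 : ℂ))).A x ≃ₜ* ℂˣ).trans
        κu) := by
  refine ⟨fun u => ?_, fun φ ψ χ h => ?_⟩
  · beta_reduce
    have h := iota_pkgAct_eventually κ hWo hxW he hem hrt
      (((Cor29Model.mult 0 : (Cor29Model.planeStructure.comap (fun _ : X => (0 : ℂ))).A x ≃ₜ* ℂˣ) u :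
        ℂˣ) : ℂ)
    refine h.mono fun v hv => ?_
    rw [hv]
    congr 1
    exact (hκu _).symm
  · beta_reduce at h
    set cφ : ℂ := (((Cor29Model.mult 0 :
      (Cor29Model.planeStructure.comap (fun _ : X => (0 : ℂ))).A x ≃ₜ* ℂˣ) φ : ℂˣ) : ℂ) with hcφ
    set cψ : ℂ := (((Cor29Model.mult 0 :
      (Cor29Model.planeStructure.comap (fun _ : X => (0 : ℂ))).A x ≃ₜ* ℂˣ) ψ : ℂˣ) : ℂ) with hcψ
    set cχ : ℂ := (((Cor29Model.mult 0 :
      (Cor29Model.planeStructure.comap (fun _ : X => (0 : ℂ))).A x ≃ₜ* ℂˣ) χ : ℂˣ) : ℂ) with hcχ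
    obtain ⟨v, -, hne, hv⟩ := exists_ne_of_eventually_pkg hr hxW he' he'm hl hrt
      ((h.and (eventually_pkg_act hWo hxW he hem hrt cφ)).and
        ((eventually_pkg_act hWo hxW he hem hrt cψ).and
          ((eventually_pkg_act hWo hxW he hem hrt cχ).and (eventually_pkg_act hWo hxW he hem hrt (cφ + cψ)))))
    obtain ⟨⟨hvχ, -, hφ⟩, ⟨-, hψ⟩, ⟨hχm, -⟩, ⟨hsm, -⟩⟩ := hv
    have hvχ' : e' (e x + cχ * (e v - e x)) = e' (e x + (cφ + cψ) * (e v - e x)) := by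
      rw [hvχ, hφ, hψ]
      congr 1
      ring
    have hinj : e x + cχ * (e v - e x) = e x + (cφ + cψ) * (e v - e x) := by
      rw [← hrt _ hχm, ← hrt _ hsm, hvχ']
    have hvx : e v - e x ≠ 0 := sub_ne_zero.2 hne
    have h3 : cχ * (e v - e x) = (cφ + cψ) * (e v - e x) := by linear_combination hinj
    have h4 := mul_right_cancel₀ hvx h3
    have key : ((((Cor29Model.mult 0 :
        (Cor29Model.planeStructure.comap (fun _ : X => (0 : ℂ))).A x ≃ₜ* ℂˣ).trans κu) χ : 𝕜ˣ) : 𝕜) =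
        ((((Cor29Model.mult 0 :
          (Cor29Model.planeStructure.comap (fun _ : X => (0 : ℂ))).A x ≃ₜ* ℂˣ).trans κu) φ : 𝕜ˣ) : 𝕜) +
        ((((Cor29Model.mult 0 :
          (Cor29Model.planeStructure.comap (fun _ : X => (0 : ℂ))).A x ≃ₜ* ℂˣ).trans κu) ψ : 𝕜ˣ) : 𝕜) := by
      simp only [ContinuousMulEquiv.trans_apply, hκu]
      rw [← map_add]
      exact congrArg κ h4
    exact key

omit [TopologicalSpace X] in
/-- **Row b.r4 for chart packages** (`ScalarCompatibleWithTrans`): with every point the origin of its own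
chart, the transition isomorphisms of `planeStructure.comap (fun _ ↦ 0)` are identities, and the scalar
isomorphisms `E` at two points are (trivially) compatible with them.
[cite: MochizukiAbsTopIII2015, Corollary 2.9 (b) p.65] -/
theorem scalarCompatibleWithTrans_pkg (κu : ℂˣ ≃ₜ* 𝕜ˣ) (x₁ x₂ : X) :
    ScalarCompatibleWithTrans (𝕜 := 𝕜) (Cor29Model.planeStructure.comap (fun _ : X => (0 : ℂ))) x₁ x₂
      ((Cor29Model.mult 0 : (Cor29Model.planeStructure.comap (fun _ : X => (0 : ℂ))).A x₁ ≃ₜ* ℂˣ).trans κu)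
      ((Cor29Model.mult 0 : (Cor29Model.planeStructure.comap (fun _ : X => (0 : ℂ))).A x₂ ≃ₜ* ℂˣ).trans κu) := by
  unfold ScalarCompatibleWithTrans
  rw [LocalLinearHolStructure.comap_trans, Cor29Model.planeStructure.trans_self]
  rfl


end Values

end ArchimedeanReconstruction.Cor29ChartPackage

end Literature.AnabelianGeometry.AbsoluteAnabelian

end
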